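/-
Copyright (c) 2026 the pub-hodgecm-mathlib formalisation cell (harness21).  Prover seat hodgecm-mathlib-K2E3-p14 (g3) ((SC-an) line lead since dealer (D28)), HCML Track B
«K2-LIT» (build stream 29), h413 = `stmt-HodgeConjecture-24833`, line `K2_E3_EllipticInputs`, unit U12 «Characters», socket #11 road (11-SC), letter (SC-an), END-GAME
MAP v2 (`K2/STATUS.md` 2026-09-04T02:38:32Z) piece (M5d) «THE EXPLICIT RADIUS»: ★ [M4]'s shell vanishing and consumer shapes with the radius `R = m_C + (1 + 2s + 4m_C) + s`
READ OFF (not `∃ R`), so that the domination half (SC-dom) can bound `R` through (D2).  2026-09-04.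
-/
import Summits.HodgeConjecture.HodgeConjecture.Theorems.K2E3SupercuspidalTruncatedCharThm20     -- ★ p856742 [M4] (K2E3-p20 (g3)): the `∃ R` forms; brings ★ [M1], ★ [M3] `cuspForm_cancellation_levelOne_U3`, ★ (f1)
import HarnessLib

/-!
# K2_E3 road (h413), socket #11 (SC-an), END-GAME MAP v2 piece (M5d): THE EXPLICIT RADIUS OF THEOREM 20's SHELL VANISHING —
# `∫_{Ω n ∖ Ω (m_C + (1 + 2s + 4 m_C) + s)} θ(x (y t y⁻¹) x⁻¹) dx = 0` on `U(σ, Φ₃)(K)`, `Θₙ(g) = ∫_{Ω n ∩ Ω R}`, `Θₙ(g) → Θ_R(g)` with `R` explicit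

Cell `pub/hodgecm-mathlib`, Track B «K2-LIT», crux H413 = `stmt-HodgeConjecture-24833` (`--supports … --as helper`, count-neutral).  ★ [M4]
`K2E3SupercuspidalTruncatedCharThm20` (K2E3-p20 (g3)) proves, for `g = y t y⁻¹` split-regular and `θ = B u' (ρ(·) u)` a supercuspidal coefficient, `∃ R, ∀ n,
∫_{Ω n ∖ Ω R} θ(x g x⁻¹) dx = 0`; inside its proof `R = m_C + (1 + 2s + 4 m_C) + s` where `C ⊆ Ω m_C` carries the support datum `supp f_t ⊆ C·T` and `y ∈ Ω s` — the radius of ★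
`cuspForm_cancellation_levelOne_U3` (K2E3-p21 (g3) over ★ (T20-e1′) `cuspForm_cancellation_levelOne`), print's `1 + σ(x) ≤ c(1+σ(C_γ))(1+σ(y₀))` [HarishChandra1970 VII §3 p. 71].
The DOMINATION half (SC-dom) needs this radius as a FUNCTION of `(m_C, s)` (then ★ (D2) `K2E3ConjugatorHeightControlRankOne` bounds `m_C`, `s` by the discriminant height `λ(t)`, HC's
Cor. of Thm 18 ∕ p. 71 (ii), and the `A`-volume slicing (M5b) turns `Ω R` into the polynomial weight `(1+|λ|)^4`).  This file re-reads ★ [M4] with `(C, m_C, s)` as INPUTS: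
* **`setIntegral_sdiff_heightBall_coeff_conj_eq_zero_of_subset`** — `∀ n, ∫ x in Ω n ∖ Ω (m_C + (1 + 2s + 4m_C) + s), θ(x (y t y⁻¹) x⁻¹) dμ = 0` (★ [M4]'s proof verbatim with ★
  `cuspForm_cancellation_levelOne_U3` in place of its `∃`-packaged `_of_isCompact` twin);
* **`truncatedCoeff_eq_inter_and_tendsto_of_subset`** — `Θₙ(g) = ∫_{Ω n ∩ Ω R}` for all `n` and `Θₙ(g) → Θ_R(g)`, `R = m_C + (1 + 2s + 4m_C) + s` (★ (f1) §4);
* `radius_eq` — `m_C + (1 + 2s + 4m_C) + s = 5 m_C + 3 s + 1` (the linear shape (M5e) feeds to (D2)).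
Currency = ★ [M4]'s (K2E3-p21 (g3)'s `Valued K ℤᵐ⁰` ∕ `hσv` ∕ `J = Φ₃` frame + [M1]'s `h2 hZs hZc hϖ'`), all discharged at `K = L_w` by ★ [M2a] `K2E3SupercuspModelFrameAtPlace[Cartan]`.

HONEST LABEL: HC_CM is proved only modulo the 7 printed citations (2 remaining named inputs: hLiu418 = stmt-HodgeConjecture-24832, h413 =
stmt-HodgeConjecture-24833) until rung 0 closes; this file is a count-neutral helper.

## References
* [HarishChandra1970] Harish-Chandra (notes by G. van Dijk), *Harmonic Analysis on Reductive p-adic Groups*, LNM 162 (1970), Part VII §2 Theorem 20 p. 70;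
  §3 p. 71 eq. (1) and (ii), p. 72 (`Ω(γ)`, `c₁(1+|λ(γ)|)²`).
* [Rogawski1990] J. D. Rogawski, *Automorphic Representations of Unitary Groups in Three Variables*, Ann. of Math. Stud. 123 (1990), §1.10 p. 9, §4.9 p. 54.
-/

set_option autoImplicit false
-- the mandated namespace repeats the single-problem summit's segment (`HodgeConjecture.HodgeConjecture`)
set_option linter.dupNamespace false

noncomputable section

open MeasureTheory Measure Set Filter Topology
open scoped NNReal ENNReal Pointwise Matrix MatrixGroups WithZero
open ValuativeRel
open Literature.NumberTheory.Automorphic Literature.NumberTheory.Automorphic.UnitaryGroup Literature.NumberTheory.Rogawski1990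

namespace Summit.HodgeConjecture.HodgeConjecture.Cruxes.H413.K2E3SupercuspidalTruncatedCharThm20Radius

variable {K : Type*} [Field K] [Valued K ℤᵐ⁰] [ValuativeRel K] [(Valued.v : Valuation K ℤᵐ⁰).Compatible] [IsNonarchimedeanLocalField K]

/-- The radius of Theorem 20's ball is LINEAR in the support height `m_C` and the conjugator height `s`: `m_C + (1 + 2s + 4m_C) + s = 5m_C + 3s + 1`.
[cite: HarishChandra1970, Part VII §3 p. 71 (ii)] -/
theorem radius_eq (mC s : ℕ) : mC + (1 + 2 * s + 4 * mC) + s = 5 * mC + 3 * s + 1 := by ring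

set_option synthInstance.maxHeartbeats 400000 in
set_option maxHeartbeats 1600000 in
-- instance-term unification on the model carriers (same class and values as ★ [M4])
/-- **THE SHELL VANISHING WITH EXPLICIT RADIUS**: for `g = y t y⁻¹` (`t = diag d` regular, `y ∈ Ω s`), `θ = B u' (ρ(·) u)` a coefficient of a smooth supercuspidal `ρ` of `U(σ, Φ₃)(K)`
whose slice `f_t(x) = θ(x t x⁻¹)` is supported in `C·T` with `C ⊆ Ω m_C`, `μ` a left- and right-invariant Haar measure and `Ω` the height-ball exhaustion:
`∫_{Ω n ∖ Ω (m_C + (1 + 2s + 4m_C) + s)} θ(x g x⁻¹) dμ(x) = 0` for EVERY `n` — ★ [M4] `setIntegral_sdiff_heightBall_coeff_conj_eq_zero`'s proof with ★ `cuspForm_cancellation_levelOne_U3`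
(explicit radius) in place of `…_of_isCompact`. [cite: HarishChandra1970, Part VII §2 Theorem 20 p. 70; §3 p. 71 eq. (1), (ii)] [cite: Rogawski1990, §4.9 p. 54] -/
theorem setIntegral_sdiff_heightBall_coeff_conj_eq_zero_of_subset [SecondCountableTopology K] [SecondCountableTopology (GL (Fin 3) K)]
    [MeasurableSpace K] [BorelSpace K]
    (σ : K →+* K) (hσ : ∀ x, σ (σ x) = x) (hσc : Continuous σ) (hσv : ∀ x, Valued.v (σ x) = Valued.v x) (h2 : (2 : K) ≠ 0)
    {J : Matrix (Fin 3) (Fin 3) K} (hJ : J = (StdForm.antidiagonal 3).over K)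
    [MeasurableSpace ↥(unitaryGroupOfForm σ J)] [BorelSpace ↥(unitaryGroupOfForm σ J)]
    [SecondCountableTopology ↥(unitaryGroupOfForm σ J)] [LocallyCompactSpace ↥(unitaryGroupOfForm σ J)]
    (μ : Measure ↥(unitaryGroupOfForm σ J)) [μ.IsHaarMeasure] [μ.IsMulRightInvariant]
    {ϖ : K} (hϖ : Valued.v ϖ = WithZero.exp (-1 : ℤ)) {ϖ' : K} (hϖ'0 : ϖ' ≠ 0) (hϖ'1 : valuation K ϖ' < 1) (hσϖ' : σ ϖ' = ϖ')
    (hZs : ∀ z ∈ Subgroup.center ↥(unitaryGroupOfForm σ J), ∃ c : Kˣ,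
      ((z : ↥(unitaryGroupOfForm σ J)) : GL (Fin 3) K) = Matrix.GeneralLinearGroup.scalar (Fin 3) c)
    (hZc : IsCompact ((Subgroup.center ↥(unitaryGroupOfForm σ J) : Subgroup ↥(unitaryGroupOfForm σ J)) : Set ↥(unitaryGroupOfForm σ J)))
    (Ω : CompactExhaustion ↥(unitaryGroupOfForm σ J))
    (hmem : ∀ (m : ℕ) (g : ↥(unitaryGroupOfForm σ J)), g ∈ Ω m ↔
      (∀ i j, Valued.v (ϖ ^ m * ((g : GL (Fin 3) K) : Matrix (Fin 3) (Fin 3) K) i j) ≤ 1) ∧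
        ∀ i j, Valued.v (ϖ ^ m * (((g : GL (Fin 3) K)⁻¹ : GL (Fin 3) K) : Matrix (Fin 3) (Fin 3) K) i j) ≤ 1)
    (hinv : ∀ (m : ℕ) (g : ↥(unitaryGroupOfForm σ J)), g ∈ Ω m → g⁻¹ ∈ Ω m)
    (hmul : ∀ (a b : ℕ) (g h : ↥(unitaryGroupOfForm σ J)), g ∈ Ω a → h ∈ Ω b → g * h ∈ Ω (a + b))
    {V : Type*} [AddCommGroup V] [Module ℂ V] (ρ : Representation ℂ ↥(unitaryGroupOfForm σ J) V) (hsm : ρ.IsSmooth) (hsc : ρ.IsSupercuspidal)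
    (B : V →ₗ⋆[ℂ] V →ₗ[ℂ] ℂ) (hBinv : ∀ (g : ↥(unitaryGroupOfForm σ J)) (x y : V), B (ρ g x) (ρ g y) = B x y) (u u' : V)
    (t : ↥(unitaryGroupOfForm σ J)) {d : Fin 3 → Kˣ} (hd : glDiagonal 3 K d = (t : GL (Fin 3) K)) (hreg : IsRegularElt (t : GL (Fin 3) K))
    (C : Set ↥(unitaryGroupOfForm σ J)) {mC : ℕ} (hCΩ : C ⊆ Ω mC)
    (hsupp : ∀ x : ↥(unitaryGroupOfForm σ J), B u' (ρ (x * t * x⁻¹) u) ≠ 0 →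
      x ∈ C * ((torusU σ J : Subgroup ↥(unitaryGroupOfForm σ J)) : Set ↥(unitaryGroupOfForm σ J)))
    {s : ℕ} {y : ↥(unitaryGroupOfForm σ J)} (hy : y ∈ Ω s) (n : ℕ) :
    ∫ x in Ω n \ Ω (mC + (1 + 2 * s + 4 * mC) + s), B u' (ρ (x * (y * t * y⁻¹) * x⁻¹) u) ∂μ = 0 := by
  haveI : T2Space K := (Literature.NumberTheory.GaloisRepresentations.IsNonarchimedeanLocalField.isLocalField K).toT2Space
  -- `N` and `N̄` are closed subgroups of the locally compact `U`: Haar measures on both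
  have hN : IsClosed (((borelTriple σ J hJ).N : Subgroup ↥(unitaryGroupOfForm σ J)) : Set ↥(unitaryGroupOfForm σ J)) :=
    (isClosed_upperUnitriangular (n := 3) (R := K)).preimage continuous_subtype_val
  have hNbar : IsClosed ((((borelTriple σ J hJ).N).map (MulAut.conj (weylLongU σ hJ)).toMonoidHom : Subgroup ↥(unitaryGroupOfForm σ J)) :
      Set ↥(unitaryGroupOfForm σ J)) := by
    have himg : ((((borelTriple σ J hJ).N).map (MulAut.conj (weylLongU σ hJ)).toMonoidHom : Subgroup ↥(unitaryGroupOfForm σ J)) :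
        Set ↥(unitaryGroupOfForm σ J)) =
        ((Homeomorph.mulLeft (weylLongU σ hJ)).trans (Homeomorph.mulRight (weylLongU σ hJ)⁻¹)) ''
          (((borelTriple σ J hJ).N : Subgroup ↥(unitaryGroupOfForm σ J)) : Set ↥(unitaryGroupOfForm σ J)) := by
      rw [Subgroup.coe_map]
      rfl
    rw [himg]
    exact (Homeomorph.isClosed_image _).2 hN
  -- (the subtype measurable structures on `↥N`, `↥N̄` are Borel: Mathlib `Subtype.borelSpace`)
  haveI : LocallyCompactSpace ↥((borelTriple σ J hJ).N) := hN.isClosedEmbedding_subtypeVal.locallyCompactSpace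
  haveI : LocallyCompactSpace ↥(((borelTriple σ J hJ).N).map (MulAut.conj (weylLongU σ hJ)).toMonoidHom) :=
    hNbar.isClosedEmbedding_subtypeVal.locallyCompactSpace
  haveI : SecondCountableTopology ↥((borelTriple σ J hJ).N) := TopologicalSpace.Subtype.secondCountableTopology _
  haveI : SecondCountableTopology ↥(((borelTriple σ J hJ).N).map (MulAut.conj (weylLongU σ hJ)).toMonoidHom) :=
    TopologicalSpace.Subtype.secondCountableTopology _
  set ν : Measure ↥((borelTriple σ J hJ).N) := Measure.haar with hν
  set νbar : Measure ↥(((borelTriple σ J hJ).N).map (MulAut.conj (weylLongU σ hJ)).toMonoidHom) := Measure.haar with hνbar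
  -- the slice `f_t` is a cusp form (★ [M1])
  have hf : Continuous fun x : ↥(unitaryGroupOfForm σ J) => B u' (ρ (x * t * x⁻¹) u) :=
    K2E3SupercuspOrbitalSliceCuspidalModel.continuous_coeff_conj σ ρ hsm B t u u'
  have hcusp : ∀ x : ↥(unitaryGroupOfForm σ J), ∫ n : ↥((borelTriple σ J hJ).N),
      (fun x : ↥(unitaryGroupOfForm σ J) => B u' (ρ (x * t * x⁻¹) u)) (x * ↑n) ∂ν = 0 := fun x =>
    K2E3SupercuspOrbitalSliceCuspidalModel.integral_coeff_slice_unipotentU_eq_zero_of_isSupercuspidal σ hσ hσc h2 hJ hZs hZc hϖ'0 hϖ'1 hσϖ'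
      ρ hsm hsc B hBinv ν t hd hreg u u' x
  have hcuspbar : ∀ x : ↥(unitaryGroupOfForm σ J), ∫ v : ↥(((borelTriple σ J hJ).N).map (MulAut.conj (weylLongU σ hJ)).toMonoidHom),
      (fun x : ↥(unitaryGroupOfForm σ J) => B u' (ρ (x * t * x⁻¹) u)) (x * ↑v) ∂νbar = 0 := fun x =>
    K2E3SupercuspOrbitalSliceCuspidalModel.integral_coeff_slice_unipotentU_map_conj_weylLongU_eq_zero_of_isSupercuspidal σ hσ hσc h2 hJ hZs hZc
      hϖ'0 hϖ'1 hσϖ' ρ hsm hsc B hBinv νbar t hd hreg u u' x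
  -- THEOREM 20 on the full level `K₁`, explicit radius (★ `cuspForm_cancellation_levelOne_U3`)
  have h20 : ∀ x : ↥(unitaryGroupOfForm σ J), x ∉ Ω (mC + (1 + 2 * s + 4 * mC) + s) →
      ∫ k in (((congruenceGL 3 (1 : ValueGroupWithZero K)).comap (unitaryGroupOfForm σ J).subtype : Subgroup ↥(unitaryGroupOfForm σ J)) :
        Set ↥(unitaryGroupOfForm σ J)), (fun x : ↥(unitaryGroupOfForm σ J) => B u' (ρ (x * t * x⁻¹) u)) (x * k * y) ∂μ = 0 := fun x hx =>
    K2E3CuspFormCancellationU3LevelOne.cuspForm_cancellation_levelOne_U3 σ hσc hσv hJ μ ν νbar hϖ Ω hmem hinv hmul hy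
      (fun x : ↥(unitaryGroupOfForm σ J) => B u' (ρ (x * t * x⁻¹) u)) hf C hCΩ hsupp hcusp hcuspbar hx
  -- the level `K₁ = U ∩ GL₃(𝒪)`: compact, open, inside `Ω 0`
  obtain ⟨hK₁c, hK₁o⟩ := isCompact_isOpen_comap_congruenceGL σ hσc (γ := (1 : ValueGroupWithZero K)) one_ne_zero
  have hK₁Ω : (((congruenceGL 3 (1 : ValueGroupWithZero K)).comap (unitaryGroupOfForm σ J).subtype : Subgroup ↥(unitaryGroupOfForm σ J)) :
      Set ↥(unitaryGroupOfForm σ J)) ⊆ Ω 0 :=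
    K2E3CuspFormCancellationU3Inputs.coe_level_subset_heightBall_zero σ Ω hmem 1
  -- the shell `Ω n ∖ Ω R` is measurable, relatively compact and right-`K₁`-invariant
  have hSm : MeasurableSet (Ω n \ Ω (mC + (1 + 2 * s + 4 * mC) + s)) :=
    (Ω.isCompact n).measurableSet.diff (Ω.isCompact _).measurableSet
  have hSc : IsCompact (closure (Ω n \ Ω (mC + (1 + 2 * s + 4 * mC) + s))) := (Ω.isCompact n).closure_of_subset sdiff_subset
  have hSK : ∀ x ∈ Ω n \ Ω (mC + (1 + 2 * s + 4 * mC) + s),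
      ∀ k ∈ ((congruenceGL 3 (1 : ValueGroupWithZero K)).comap (unitaryGroupOfForm σ J).subtype : Subgroup ↥(unitaryGroupOfForm σ J)),
        x * k ∈ Ω n \ Ω (mC + (1 + 2 * s + 4 * mC) + s) := by
    intro x hx k hk
    refine ⟨by simpa using hmul n 0 x k hx.1 (hK₁Ω hk), fun hxk => hx.2 ?_⟩
    simpa using hmul _ 0 (x * k) k⁻¹ hxk (hinv 0 k (hK₁Ω hk))
  -- Theorem 20 kills every `K₁`-average on the shell
  have hφ : Continuous fun z : ↥(unitaryGroupOfForm σ J) => B u' (ρ (z * (y * t * y⁻¹) * z⁻¹) u) :=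
    K2E3SupercuspOrbitalSliceCuspidalModel.continuous_coeff_conj σ ρ hsm B (y * t * y⁻¹) u u'
  have h0 : ∀ x ∈ Ω n \ Ω (mC + (1 + 2 * s + 4 * mC) + s),
      ∫ k in (((congruenceGL 3 (1 : ValueGroupWithZero K)).comap (unitaryGroupOfForm σ J).subtype : Subgroup ↥(unitaryGroupOfForm σ J)) :
        Set ↥(unitaryGroupOfForm σ J)), B u' (ρ (x * k * (y * t * y⁻¹) * (x * k)⁻¹) u) ∂μ = 0 := by
    intro x hx
    have h := h20 x hx.2
    rw [← h]
    refine setIntegral_congr_fun hK₁o.measurableSet fun k _ => ?_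
    congr 2
    group
  exact K2E3RightInvariantSetIntegralVanishing.setIntegral_eq_zero_of_forall_setIntegral_mul_eq_zero μ _ hK₁c
    (hK₁o.measure_ne_zero μ ⟨1, Subgroup.one_mem _⟩) hSm hSc hSK _ hφ h0

set_option synthInstance.maxHeartbeats 400000 in
set_option maxHeartbeats 1600000 in
-- instance-term unification on the model carriers (same class and values as ★ [M4])
/-- **THE TWO CONSUMER SHAPES WITH EXPLICIT RADIUS** at a split-regular `g = y t y⁻¹` (`y ∈ Ω s`, slice support `⊆ C·T`, `C ⊆ Ω m_C`): with `R := m_C + (1 + 2s + 4m_C) + s`,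
`Θₙ(g) = ∫_{Ω n ∩ Ω R} θ(x g x⁻¹) dμ` for every `n` (the `hcanc` shape of ★ `K2E3SupercuspidalTruncatedCharDominationOfBricks` with `Bset g := Ω R`) and `Θₙ(g) → Θ_R(g)` (the `hlim`
shape). [cite: HarishChandra1970, Part VII §3 p. 71 eq. (1), p. 72] -/
theorem truncatedCoeff_eq_inter_and_tendsto_of_subset [SecondCountableTopology K] [SecondCountableTopology (GL (Fin 3) K)]
    [MeasurableSpace K] [BorelSpace K]
    (σ : K →+* K) (hσ : ∀ x, σ (σ x) = x) (hσc : Continuous σ) (hσv : ∀ x, Valued.v (σ x) = Valued.v x) (h2 : (2 : K) ≠ 0)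
    {J : Matrix (Fin 3) (Fin 3) K} (hJ : J = (StdForm.antidiagonal 3).over K)
    [MeasurableSpace ↥(unitaryGroupOfForm σ J)] [BorelSpace ↥(unitaryGroupOfForm σ J)]
    [SecondCountableTopology ↥(unitaryGroupOfForm σ J)] [LocallyCompactSpace ↥(unitaryGroupOfForm σ J)]
    (μ : Measure ↥(unitaryGroupOfForm σ J)) [μ.IsHaarMeasure] [μ.IsMulRightInvariant]
    {ϖ : K} (hϖ : Valued.v ϖ = WithZero.exp (-1 : ℤ)) {ϖ' : K} (hϖ'0 : ϖ' ≠ 0) (hϖ'1 : valuation K ϖ' < 1) (hσϖ' : σ ϖ' = ϖ')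
    (hZs : ∀ z ∈ Subgroup.center ↥(unitaryGroupOfForm σ J), ∃ c : Kˣ,
      ((z : ↥(unitaryGroupOfForm σ J)) : GL (Fin 3) K) = Matrix.GeneralLinearGroup.scalar (Fin 3) c)
    (hZc : IsCompact ((Subgroup.center ↥(unitaryGroupOfForm σ J) : Subgroup ↥(unitaryGroupOfForm σ J)) : Set ↥(unitaryGroupOfForm σ J)))
    (Ω : CompactExhaustion ↥(unitaryGroupOfForm σ J))
    (hmem : ∀ (m : ℕ) (g : ↥(unitaryGroupOfForm σ J)), g ∈ Ω m ↔
      (∀ i j, Valued.v (ϖ ^ m * ((g : GL (Fin 3) K) : Matrix (Fin 3) (Fin 3) K) i j) ≤ 1) ∧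
        ∀ i j, Valued.v (ϖ ^ m * (((g : GL (Fin 3) K)⁻¹ : GL (Fin 3) K) : Matrix (Fin 3) (Fin 3) K) i j) ≤ 1)
    (hinv : ∀ (m : ℕ) (g : ↥(unitaryGroupOfForm σ J)), g ∈ Ω m → g⁻¹ ∈ Ω m)
    (hmul : ∀ (a b : ℕ) (g h : ↥(unitaryGroupOfForm σ J)), g ∈ Ω a → h ∈ Ω b → g * h ∈ Ω (a + b))
    {V : Type*} [AddCommGroup V] [Module ℂ V] (ρ : Representation ℂ ↥(unitaryGroupOfForm σ J) V) (hsm : ρ.IsSmooth) (hsc : ρ.IsSupercuspidal)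
    (B : V →ₗ⋆[ℂ] V →ₗ[ℂ] ℂ) (hBinv : ∀ (g : ↥(unitaryGroupOfForm σ J)) (x y : V), B (ρ g x) (ρ g y) = B x y) (u u' : V)
    (t : ↥(unitaryGroupOfForm σ J)) {d : Fin 3 → Kˣ} (hd : glDiagonal 3 K d = (t : GL (Fin 3) K)) (hreg : IsRegularElt (t : GL (Fin 3) K))
    (C : Set ↥(unitaryGroupOfForm σ J)) {mC : ℕ} (hCΩ : C ⊆ Ω mC)
    (hsupp : ∀ x : ↥(unitaryGroupOfForm σ J), B u' (ρ (x * t * x⁻¹) u) ≠ 0 →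
      x ∈ C * ((torusU σ J : Subgroup ↥(unitaryGroupOfForm σ J)) : Set ↥(unitaryGroupOfForm σ J)))
    {s : ℕ} {y : ↥(unitaryGroupOfForm σ J)} (hy : y ∈ Ω s) :
    (∀ n : ℕ, ∫ x in Ω n, B u' (ρ (x * (y * t * y⁻¹) * x⁻¹) u) ∂μ =
        ∫ x in Ω n ∩ Ω (mC + (1 + 2 * s + 4 * mC) + s), B u' (ρ (x * (y * t * y⁻¹) * x⁻¹) u) ∂μ) ∧
      Tendsto (fun n : ℕ => ∫ x in Ω n, B u' (ρ (x * (y * t * y⁻¹) * x⁻¹) u) ∂μ) atTop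
        (𝓝 (∫ x in Ω (mC + (1 + 2 * s + 4 * mC) + s), B u' (ρ (x * (y * t * y⁻¹) * x⁻¹) u) ∂μ)) := by
  haveI : T2Space K := (Literature.NumberTheory.GaloisRepresentations.IsNonarchimedeanLocalField.isLocalField K).toT2Space
  have hR := setIntegral_sdiff_heightBall_coeff_conj_eq_zero_of_subset σ hσ hσc hσv h2 hJ μ hϖ hϖ'0 hϖ'1 hσϖ' hZs hZc Ω hmem hinv hmul ρ hsm hsc B hBinv
    u u' t hd hreg C hCΩ hsupp hy
  have hφ : Continuous fun z : ↥(unitaryGroupOfForm σ J) => B u' (ρ (z * (y * t * y⁻¹) * z⁻¹) u) :=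
    K2E3SupercuspOrbitalSliceCuspidalModel.continuous_coeff_conj σ ρ hsm B (y * t * y⁻¹) u u'
  have hmeas : ∀ n, MeasurableSet (Ω n) := fun n => (Ω.isCompact n).measurableSet
  have hint : ∀ n, IntegrableOn (fun z : ↥(unitaryGroupOfForm σ J) => B u' (ρ (z * (y * t * y⁻¹) * z⁻¹) u)) (Ω n) μ := fun n =>
    hφ.continuousOn.integrableOn_compact (Ω.isCompact n)
  exact ⟨K2E3RightInvariantSetIntegralVanishing.setIntegral_eq_setIntegral_inter_of_sdiff_eq_zero μ Ω hmeas _ _ hint hR,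
    K2E3RightInvariantSetIntegralVanishing.tendsto_setIntegral_of_forall_sdiff_eq_zero μ Ω (fun _ _ h => Ω.subset h) hmeas _ _ hint hR⟩

end Summit.HodgeConjecture.HodgeConjecture.Cruxes.H413.K2E3SupercuspidalTruncatedCharThm20Radius

end
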